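import Literature.Geometry.Lorentzian.Stationary
import Literature.Geometry.Lorentzian.CompleteStationaryVacuumFlatProofs
import HarnessLib

/-!
# Functions invariant under the flow of a vector field: `df(V) = 0`, invariant sublevel sets,
# and spacelike gradients where the field is timelike

Elementary calculus of a real function `f` constant along the (whole-line) integral curves of a
vector field `V` on a manifold `M` — the situation of a *stationary* function `T(f) = 0` on a
stationary space-time, where `T` is the stationary Killing field (Chruściel–Costa 2008, §4.2: the
structure theorem `⟨⟨M_ext⟩⟩ ≈ ℝ × S₀` makes the `φₜ`-invariant functions on the domain of outer
communications the functions on `S₀`).  Everything here is LOCAL along a curve or relative to a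
flow-invariant subset `A` (typically an open flow-invariant region such as a domain of outer
communications, on which alone `f` is assumed differentiable), in contrast with the global
`apply_eq_apply_of_isMIntegralCurve_of_mvfderiv_eq_zero` of
`AxisymmetricBlackHoleUniquenessProofs.lean` (`f` differentiable and `df(X) = 0` everywhere):

* `mfderiv_apply_eq_zero_of_isMIntegralCurve_of_forall_apply_eq` — **invariance ⇒ `df(V) = 0`**:
  if `f` is constant along an integral curve `γ` of `V` and differentiable at `γ t₀`, then
  `df_{γ t₀}(V) = 0` (chain rule `hasDerivAt_comp_curve` and uniqueness of derivatives);
  `mfderiv_apply_eq_zero_of_invariant` — the same for a function invariant under all integral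
  curves starting in a set `A` through whose points integral curves pass;
* `apply_eq_apply_of_isMIntegralCurve_of_forall_mem` — **`df(V) = 0` on `A` ⇒ invariance** along
  every integral curve contained in `A` (Mathlib's `is_const_of_deriv_eq_zero`), with the
  `ContMDiffOn` form `apply_eq_apply_of_isMIntegralCurve_of_contMDiffOn` for `A` open;
* `mem_and_apply_mem_of_isMIntegralCurve` and `forall_mem_sep_lt_of_isMIntegralCurve` —
  **sublevel (level, superlevel, …) sets of an invariant function cut out of a flow-invariant set
  are flow-invariant**;
* `LorentzianMetric.exists_pos_val_and_eq_val_of_apply_eq_zero` — **a non-zero covector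
  annihilating a timelike vector is metrically dual to a spacelike vector**: `α(T) = 0`, `α ≠ 0`,
  `T` timelike ⇒ `α = g(w, ·)` with `g(w, w) > 0` (`w = ♯α` is `g`-orthogonal to `T`; reverse
  Cauchy–Schwarz / O'Neill 1983, Ch. 5, Lemma 5.26), and its differential form
  `LorentzianMetric.exists_pos_val_and_mfderiv_eq_val` — **outside the ergoregion a `T`-invariant
  function with `df ≠ 0` has spacelike gradient**, i.e. its level sets are timelike hypersurfaces
  (the timelike level sets `{r = const}` of the Boyer–Lindquist radius on the Kerr exterior away
  from the ergoregion are the model).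

Everything is proved; no definitions, no named facts.

## References

* P. T. Chruściel, J. L. Costa, *On uniqueness of stationary vacuum black holes*, Astérisque 321
  (2008) 195–265, arXiv:0806.0016, §4.2 (Thm. 4.5, the structure theorem; invariant functions and
  hypersurfaces transverse to the stationary flow) (key `ChruscielCosta2008`).
* B. O'Neill, *Semi-Riemannian geometry*, Academic Press 1983, Ch. 1, Def. 1.46 ff. (integral
  curves), Ch. 3, p. 60 (musical isomorphisms), Ch. 5, Lemma 5.26 (the orthogonal complement of a
  timelike vector is spacelike) (key `ONeill1983`).
-/

noncomputable section

open Bundle Set Function Filter Manifold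
open scoped Manifold ContDiff Topology

namespace Literature.Geometry.Lorentzian

universe u

variable {E : Type*} [NormedAddCommGroup E] [NormedSpace ℝ E] {H : Type*} [TopologicalSpace H]
  {I : ModelWithCorners ℝ E H} {M : Type*} [TopologicalSpace M] [ChartedSpace H M]

/-! ### Invariance along integral curves forces `df(V) = 0` -/

/-- **A function constant along an integral curve has vanishing derivative along the field.**
If `γ` is an integral curve of `V`, `f` is differentiable at `γ t₀` and `f (γ t) = f (γ t₀)` for
all `t`, then `df_{γ t₀}(V (γ t₀)) = 0`: the real function `f ∘ γ` is constant, and by the chain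
rule its derivative at `t₀` is `df_{γ t₀}(γ' t₀) = df_{γ t₀}(V (γ t₀))`. O'Neill 1983, Ch. 1,
Def. 1.46 ff. [folklore] -/
theorem mfderiv_apply_eq_zero_of_isMIntegralCurve_of_forall_apply_eq
    {V : Π x : M, TangentSpace I x} {f : M → ℝ} {γ : ℝ → M} (hγ : IsMIntegralCurve γ V) {t₀ : ℝ}
    (hf : MDifferentiableAt I 𝓘(ℝ, ℝ) f (γ t₀)) (hconst : ∀ t, f (γ t) = f (γ t₀)) :
    mfderiv I 𝓘(ℝ, ℝ) f (γ t₀) (V (γ t₀)) = 0 := by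
  have h1 : HasDerivAt (fun t ↦ f (γ t)) (mfderiv I 𝓘(ℝ, ℝ) f (γ t₀) (velocity I γ t₀)) t₀ :=
    hasDerivAt_comp_curve hf (hγ t₀).mdifferentiableAt
  rw [velocity_eq_of_isMIntegralCurve hγ t₀] at h1
  have h2 : HasDerivAt (fun t ↦ f (γ t)) 0 t₀ := by
    have h : (fun t ↦ f (γ t)) = fun _ ↦ f (γ t₀) := funext hconst
    rw [h]
    exact hasDerivAt_const t₀ (f (γ t₀))
  exact h1.unique h2

/-- **A locally constant composite suffices**: if `f ∘ γ` is eventually equal, near `t₀`, to its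
value at `t₀` (e.g. `f` is constant on the orbit segment through a neighbourhood), then
`df_{γ t₀}(V (γ t₀)) = 0`. [folklore] -/
theorem mfderiv_apply_eq_zero_of_isMIntegralCurve_of_eventuallyEq
    {V : Π x : M, TangentSpace I x} {f : M → ℝ} {γ : ℝ → M} (hγ : IsMIntegralCurve γ V) {t₀ : ℝ}
    (hf : MDifferentiableAt I 𝓘(ℝ, ℝ) f (γ t₀))
    (hconst : (fun t ↦ f (γ t)) =ᶠ[𝓝 t₀] fun _ ↦ f (γ t₀)) :
    mfderiv I 𝓘(ℝ, ℝ) f (γ t₀) (V (γ t₀)) = 0 := by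
  have h1 : HasDerivAt (fun t ↦ f (γ t)) (mfderiv I 𝓘(ℝ, ℝ) f (γ t₀) (velocity I γ t₀)) t₀ :=
    hasDerivAt_comp_curve hf (hγ t₀).mdifferentiableAt
  rw [velocity_eq_of_isMIntegralCurve hγ t₀] at h1
  have h2 : HasDerivAt (fun t ↦ f (γ t)) 0 t₀ :=
    (hasDerivAt_const t₀ (f (γ t₀))).congr_of_eventuallyEq hconst
  exact h1.unique h2

/-- **Flow-invariant functions are annihilated by the field.** Let `A ⊆ M` and suppose that
through every point of `A` passes a whole-line integral curve of `V` (e.g. `V` is complete,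
`IsCompleteVectorField`), and that `f` is invariant under the integral curves starting in `A`:
`f (γ t) = f (γ 0)` whenever `γ` is an integral curve of `V` with `γ 0 ∈ A`. Then `df_x(V x) = 0`
at every `x ∈ A` at which `f` is differentiable. For the stationary Killing field `T` of a
stationary space-time and `A` the domain of outer communications this is "`φₜ`-invariant functions
satisfy `T(f) = 0`". Chruściel–Costa 2008, §4.2. [folklore] -/
theorem mfderiv_apply_eq_zero_of_invariant {V : Π x : M, TangentSpace I x} {A : Set M}
    {f : M → ℝ} (hV : ∀ x ∈ A, ∃ γ : ℝ → M, IsMIntegralCurve γ V ∧ γ 0 = x)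
    (hinv : ∀ γ : ℝ → M, IsMIntegralCurve γ V → γ 0 ∈ A → ∀ t, f (γ t) = f (γ 0))
    {x : M} (hx : x ∈ A) (hf : MDifferentiableAt I 𝓘(ℝ, ℝ) f x) :
    mfderiv I 𝓘(ℝ, ℝ) f x (V x) = 0 := by
  obtain ⟨γ, hγ, rfl⟩ := hV x hx
  exact mfderiv_apply_eq_zero_of_isMIntegralCurve_of_forall_apply_eq hγ hf (hinv γ hγ hx)

/-! ### `df(V) = 0` on a flow-invariant set forces invariance -/

/-- **`df(V) = 0` along an integral curve forces `f` to be constant along it.** If `γ` is an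
integral curve of `V` all of whose points lie in a set `A` on which `f` is differentiable with
`df(V) = 0`, then `f (γ s) = f (γ t)` for all `s, t`: the real function `f ∘ γ` has derivative
`df_{γ t}(V (γ t)) = 0` everywhere (chain rule), hence is constant (Mathlib's
`is_const_of_deriv_eq_zero`). The set `A` is typically a flow-invariant open region carrying the
only differentiability information on `f`. Chruściel–Costa 2008, §4.2. [folklore] -/
theorem apply_eq_apply_of_isMIntegralCurve_of_forall_mem {V : Π x : M, TangentSpace I x}
    {A : Set M} {f : M → ℝ} (hf : ∀ x ∈ A, MDifferentiableAt I 𝓘(ℝ, ℝ) f x)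
    (h0 : ∀ x ∈ A, mfderiv I 𝓘(ℝ, ℝ) f x (V x) = 0) {γ : ℝ → M} (hγ : IsMIntegralCurve γ V)
    (hA : ∀ t, γ t ∈ A) (s t : ℝ) : f (γ s) = f (γ t) := by
  have hd : ∀ t, HasDerivAt (fun t' ↦ f (γ t')) 0 t := by
    intro t
    have h1 := hasDerivAt_comp_curve (hf _ (hA t)) (hγ t).mdifferentiableAt
    rw [velocity_eq_of_isMIntegralCurve hγ t, h0 _ (hA t)] at h1
    exact h1
  exact is_const_of_deriv_eq_zero (fun t ↦ (hd t).differentiableAt) (fun t ↦ (hd t).deriv) s t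

/-- **`ContMDiffOn` form.** If `f` is `C^n`, `n ≥ 1`, on an open set `A` with `df(V) = 0` on `A`,
then `f` is constant along every integral curve of `V` contained in `A`. [folklore] -/
theorem apply_eq_apply_of_isMIntegralCurve_of_contMDiffOn {V : Π x : M, TangentSpace I x}
    {A : Set M} {f : M → ℝ} {n : WithTop ℕ∞} (hA : IsOpen A) (hf : ContMDiffOn I 𝓘(ℝ, ℝ) n f A)
    (hn : n ≠ 0) (h0 : ∀ x ∈ A, mfderiv I 𝓘(ℝ, ℝ) f x (V x) = 0) {γ : ℝ → M}
    (hγ : IsMIntegralCurve γ V) (hγA : ∀ t, γ t ∈ A) (s t : ℝ) : f (γ s) = f (γ t) :=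
  apply_eq_apply_of_isMIntegralCurve_of_forall_mem
    (fun _ hx ↦ (hf.contMDiffAt (hA.mem_nhds hx)).mdifferentiableAt hn) h0 hγ hγA s t

/-- **Invariance on a flow-invariant set.** If `A` is invariant under the integral curves of `V`
(curves starting in `A` stay in `A`), `f` is differentiable on `A` with `df(V) = 0` there, then
`f (γ t) = f (γ 0)` for every integral curve `γ` starting in `A`. Chruściel–Costa 2008, §4.2. [folklore] -/
theorem apply_eq_apply_zero_of_isMIntegralCurve_of_invariant {V : Π x : M, TangentSpace I x}
    {A : Set M} {f : M → ℝ}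
    (hAinv : ∀ γ : ℝ → M, IsMIntegralCurve γ V → γ 0 ∈ A → ∀ t, γ t ∈ A)
    (hf : ∀ x ∈ A, MDifferentiableAt I 𝓘(ℝ, ℝ) f x)
    (h0 : ∀ x ∈ A, mfderiv I 𝓘(ℝ, ℝ) f x (V x) = 0) {γ : ℝ → M} (hγ : IsMIntegralCurve γ V)
    (hγ0 : γ 0 ∈ A) (t : ℝ) : f (γ t) = f (γ 0) :=
  apply_eq_apply_of_isMIntegralCurve_of_forall_mem hf h0 hγ (hAinv γ hγ hγ0) t 0

/-! ### Sublevel sets of invariant functions are invariant -/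

/-- **Sets cut out of a flow-invariant set by an invariant function are flow-invariant.** If `A`
is invariant under the integral curves of `V` and `f` is differentiable on `A` with `df(V) = 0`
there, then for any `S ⊆ ℝ` the set `{x ∈ A | f x ∈ S}` is invariant: an integral curve starting
in it stays in it (`f` is constant along the curve, which stays in `A`). With `S = (-∞, c)` these
are the flow-invariant "sub-collars" `{f < c} ∩ ⟨⟨M_ext⟩⟩` of a stationary sweep function.
Chruściel–Costa 2008, §4.2. [folklore] -/
theorem mem_and_apply_mem_of_isMIntegralCurve {V : Π x : M, TangentSpace I x} {A : Set M}
    {f : M → ℝ} (hAinv : ∀ γ : ℝ → M, IsMIntegralCurve γ V → γ 0 ∈ A → ∀ t, γ t ∈ A)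
    (hf : ∀ x ∈ A, MDifferentiableAt I 𝓘(ℝ, ℝ) f x)
    (h0 : ∀ x ∈ A, mfderiv I 𝓘(ℝ, ℝ) f x (V x) = 0) {S : Set ℝ} {γ : ℝ → M}
    (hγ : IsMIntegralCurve γ V) (hγ0 : γ 0 ∈ A) (hS : f (γ 0) ∈ S) (t : ℝ) :
    γ t ∈ A ∧ f (γ t) ∈ S := by
  refine ⟨hAinv γ hγ hγ0 t, ?_⟩
  rw [apply_eq_apply_zero_of_isMIntegralCurve_of_invariant hAinv hf h0 hγ hγ0 t]
  exact hS

/-- **Sublevel sets `{x ∈ A | f x < c}` of an invariant function on a flow-invariant set are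
flow-invariant** (the case `S = (-∞, c)` of `mem_and_apply_mem_of_isMIntegralCurve`, in
set-builder form). Chruściel–Costa 2008, §4.2. [folklore] -/
theorem forall_mem_sep_lt_of_isMIntegralCurve {V : Π x : M, TangentSpace I x} {A : Set M}
    {f : M → ℝ} (hAinv : ∀ γ : ℝ → M, IsMIntegralCurve γ V → γ 0 ∈ A → ∀ t, γ t ∈ A)
    (hf : ∀ x ∈ A, MDifferentiableAt I 𝓘(ℝ, ℝ) f x)
    (h0 : ∀ x ∈ A, mfderiv I 𝓘(ℝ, ℝ) f x (V x) = 0) (c : ℝ) {γ : ℝ → M}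
    (hγ : IsMIntegralCurve γ V) (hγ0 : γ 0 ∈ {x | x ∈ A ∧ f x < c}) (t : ℝ) :
    γ t ∈ {x | x ∈ A ∧ f x < c} :=
  mem_and_apply_mem_of_isMIntegralCurve (S := Iio c) hAinv hf h0 hγ hγ0.1 hγ0.2 t

/-- The same for an invariant function given as `ContMDiffOn … f A`, `A` open and flow-invariant
(the form in which stationary sweep functions on a domain of outer communications arise).
Chruściel–Costa 2008, §4.2. [folklore] -/
theorem forall_mem_sep_lt_of_isMIntegralCurve_of_contMDiffOn {V : Π x : M, TangentSpace I x}
    {A : Set M} {f : M → ℝ} {n : WithTop ℕ∞} (hA : IsOpen A)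
    (hAinv : ∀ γ : ℝ → M, IsMIntegralCurve γ V → γ 0 ∈ A → ∀ t, γ t ∈ A)
    (hf : ContMDiffOn I 𝓘(ℝ, ℝ) n f A) (hn : n ≠ 0)
    (h0 : ∀ x ∈ A, mfderiv I 𝓘(ℝ, ℝ) f x (V x) = 0) (c : ℝ) {γ : ℝ → M}
    (hγ : IsMIntegralCurve γ V) (hγ0 : γ 0 ∈ {x | x ∈ A ∧ f x < c}) (t : ℝ) :
    γ t ∈ {x | x ∈ A ∧ f x < c} :=
  forall_mem_sep_lt_of_isMIntegralCurve hAinv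
    (fun _ hx ↦ (hf.contMDiffAt (hA.mem_nhds hx)).mdifferentiableAt hn) h0 c hγ hγ0 t

/-! ### Spacelike gradients of invariant functions where the field is timelike -/

namespace LorentzianMetric

variable [IsManifold I ∞ M] [FiniteDimensional ℝ E] {n : ℕ∞ω} (g : LorentzianMetric I n M) {x : M}

/-- **A non-zero covector annihilating a timelike vector is the metric dual of a spacelike
vector.** If `T` is timelike, `α : T_x M → ℝ` is linear with `α T = 0` and `α ≠ 0`, then there is
`w` with `g(w, w) > 0` and `α = g(w, ·)`: take `w = ♯α` (`PseudoRiemannianMetric.sharp`); then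
`g(T, w) = α T = 0`, `w ≠ 0`, and the `g`-orthogonal complement of the timelike `T` is spacelike
(`pos_of_orthogonal`, O'Neill's Lemma 5.26). O'Neill 1983, Ch. 3, p. 60 and Ch. 5, Lemma 5.26.
[cite: ONeill1983, Ch. 5  Lemma 5.26] -/
theorem exists_pos_val_and_eq_val_of_apply_eq_zero {T : TangentSpace I x} (hT : g.IsTimelike T)
    (α : TangentSpace I x →ₗ[ℝ] ℝ) (hαT : α T = 0) (hα : α ≠ 0) :
    ∃ w : TangentSpace I x, 0 < g.val x w w ∧ ∀ u : TangentSpace I x, α u = g.val x w u := by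
  refine ⟨g.sharp x α, ?_, fun u ↦ (g.val_sharp_apply x α u).symm⟩
  have hw : g.sharp x α ≠ 0 := fun h ↦ hα (by
    have h' := congrArg (g.flat x) h
    rwa [g.flat_sharp, map_zero] at h')
  refine g.pos_of_orthogonal x T (g.sharp x α) hT ?_ hw
  rw [g.symm x, g.val_sharp_apply]
  exact hαT

/-- **Outside the ergoregion an invariant function with non-zero differential has spacelike
gradient.** For `f : M → ℝ` and a point `x` where the vector `T x` is timelike: if
`df_x(T x) = 0` and `df_x ≠ 0` then `df_x = g(w, ·)` for a vector `w` with `g(w, w) > 0` — the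
gradient `∇f(x) = ♯df_x` is orthogonal to the timelike `T x`, hence spacelike, so the level set of
`f` through `x` is a timelike hypersurface near `x`. (Where `T` is spacelike or null — the
ergoregion of a stationary black hole — this fails in general: `T^⊥` is then Lorentzian or
degenerate.) O'Neill 1983, Ch. 5, Lemma 5.26; Chruściel–Costa 2008, §4.2. [folklore] -/
theorem exists_pos_val_and_mfderiv_eq_val {T : Π y : M, TangentSpace I y} {f : M → ℝ}
    (hT : g.IsTimelike (T x)) (h0 : mfderiv I 𝓘(ℝ, ℝ) f x (T x) = 0)
    (hne : mfderiv I 𝓘(ℝ, ℝ) f x ≠ 0) :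
    ∃ w : TangentSpace I x, 0 < g.val x w w ∧
      ∀ u : TangentSpace I x, mfderiv I 𝓘(ℝ, ℝ) f x u = g.val x w u := by
  set α : TangentSpace I x →ₗ[ℝ] ℝ :=
    { toFun := fun u ↦ mfderiv I 𝓘(ℝ, ℝ) f x u
      map_add' := fun u v ↦ map_add _ u v
      map_smul' := fun c u ↦ map_smul _ c u } with hα
  have hαT : α (T x) = 0 := h0
  have hα0 : α ≠ 0 := by
    intro h
    apply hne
    ext u
    exact LinearMap.congr_fun h u
  obtain ⟨w, hw, hwu⟩ := g.exists_pos_val_and_eq_val_of_apply_eq_zero hT α hαT hα0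
  exact ⟨w, hw, fun u ↦ hwu u⟩

end LorentzianMetric

end Literature.Geometry.Lorentzian

end
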